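import Summits.QuantumFields.YangMills.Theorems.BalabanUVNodesN15CurvedGluingCubeDressedGeneralRemainderRow
import Summits.QuantumFields.YangMills.Theorems.BalabanUVNodesN15CurvedGluingCubeDressedGeneralRightEntries
import Summits.QuantumFields.YangMills.Theorems.BalabanUVNodesN15CurvedGluingCubeDressedGeneralCommutatorAdjoint
import Summits.QuantumFields.YangMills.Theorems.BalabanUVNodesN15TwoSpacingGluingAdjoint
import HarnessLib

/-!
# Route «BalabanUVNodes» (cluster K4 «SpineRates»), Track-A DAG node N15 = NE2, BACKGROUND LAYER — THE ADJOINT REMAINDER ROW OF THE GENERAL DRESSED CUBE: the FLAT half `X∘[Σ_μ∇*_μ∇_μ + W, M_h]`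
# BY NAME (dag-n15-c FILE 49's adjoint Leibniz row on file 23's two-sided entry 0 and dag-n15-w3 g4's two-sided RIGHT entries), and its assembly with the flat nonlocal summand (FILE 57) and the
# dressed perturbation's adjoint half (this seat's `…CommutatorAdjoint`) into FILE 58's one-sided `hKcL` shape `X∘[Σ∇*∇ + W + N − 𝒱, M_h] ≤ 1_S(y)·θ₀ᴸ·e^{−ρd}` — the adjoint twin of
# dag-n15-w4's `…RemainderRow`

Cell `pub-ymgap`, seat `pub-ymgap-dag-n15-w5` (WIDTH SEAT w5 on node N15, director-ym R399 (3a) ∕ HUMAN RULING D-0149; sequel (g′) of this seat's (g) `…CommutatorAdjoint` — dag-n15-w3 g3's located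
«ADJOINT-ARRANGEMENT rows», HOME `pub-ymgap-dag-n15-w3/HANDOFF.md` §«What remains after g3»; dag-n15-w3 g4 I.30945 «hKcL∕hDKL w5»).  `bears_on: R4∕N15 · K3⁷ SpineGivenEndpointR13SepCoPH
(stmt-QuantumFields-20544)`.  Filed `--kind proof --supports stmt-QuantumFields-20544 --as helper` — COUNT-NEUTRAL.  Theorems only; 0 `def`, 0 `sorry`.  Imports BY NAME dag-n15-w4
`…CubeDressedGeneralRemainderRow` (`commOp_sub_left`; through it file 23 `hasMaj_dressedV_pair` ∕ `hasMaj_dressedV_loc₂`), dag-n15-w3 g4 `…CubeDressedGeneralRightEntries`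
(`hasMaj_dressedV_comp_fgrad_loc₂` ∕ `hasMaj_dressedV_comp_bgrad_loc₂`), this seat's `…CubeDressedGeneralCommutatorAdjoint` (`hasMaj_comp_commOp_speciesOpM_add`, `unstackM_add_base_comp_jet`),
dag-n15-c FILE 49 `…TwoSpacingGluingAdjoint` (`hasMaj_comp_commOp_lapOp`) and FILE 57 (`hasMaj_comp_commOp_of_add`, through the imports); nothing in the tree is modified, nothing re-declared.

WHY.  dag-n15-c FILE 58 `gluedLetters_of_cubeRows_in` consumes per cube BOTH arrangements of the remainder's commutator row: `hKc : [Δ, M_{h_i}]∘G_i ≤ 1_{S_i}(y′)·θ₀e^{−δd}` (input-localized)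
and `hKcL : G_i∘[Δ, M_{h_i}] ≤ 1_{S_i}(y)·θ₀e^{−δd}` (output-localized; [B5] p. 39 «adjoint representation», FILE 49 `glued_adjoint_inverse`).  For dag-n15-w3's GENERAL dressed cube
(file 23: `X = pr₀X̂`, `X̂ = bgPropV (stack G₀ D) V̂`) dag-n15-w4's `…RemainderRow` delivered `hKc`.  THIS FILE delivers `hKcL`: with the cube operator `Σ∇*∇ + W + N − 𝒱` the row splits
`X∘[Σ∇*∇ + W, M_h] + X∘[N, M_h] − X∘[𝒱, M_h]`; the first is FILE 49's adjoint lattice-Leibniz row ((2.91)–(2.92) transposed), which wants the cube's TWO-SIDED entry 0 `X` (file 23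
`hasMaj_dressedV_loc₂`) and two-sided RIGHT entries `X∘∇^±_μ` (dag-n15-w3 g4 `hasMaj_dressedV_comp_fgrad_loc₂`∕`…_bgrad_loc₂`, with the one-step nested cut-off `ψ ⊂ ψ₂`); the middle is FILE 57's
output-localized composition with FILE 56's letter `[N, M_h] ≤ c_N·e^{−ρ_Nd}`; the last is this seat's `hasMaj_comp_commOp_speciesOpM_add`, which is STRUCTURAL in the perturbation — so here, unlike
in dag-n15-w4's left row, `V̂ = unstackM C A + N_V∘pr₀` (the local first-order species read on the jet plus a lettered base operator), `𝒱 = V̂∘jet = V(C, A) + N_V` (`unstackM_add_base_comp_jet`).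
* §1 ★★ `hasMaj_comp_commOp_lapOp_dressedV_loc₂` — THE FLAT ADJOINT HALF, two-sided, for ANY decaying `V̂`: `X∘[Σ_μ∇*_μ∇_μ + W, M_h] ≤ 1_S(y)1_S(y′)·(|J|(3β′c₂ + 2β′₂c₁) + θ_W)·e^{−ρ₂d}`,
  `β′ = β(1 − βRc_r²)⁻¹`, `β′₂ = β₂(1 − βRc_r²)⁻¹`, from the flat cube's data (`G₀, D_j ≤ βe^{−δd}`, right entries `G₀∇^±_μ, D_j∇^±_μ ≤ β₂e^{−δd}`, cut-offs `M_χG₀ = G₀ = G₀M_ψ` over `S`, the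
  margin `ψ₂`), the perturbation's `V̂ ≤ Re^{−δ_Vd}`, `βRc_r² < 1`, the partition's `|∇^±_μh| ≤ c₁`, the three second differences `≤ c₂`, and the `W`-row `X∘[W, M_h] ≤ 1_S1_S·θ_We^{−ρ₂d}` (displayed);
* §2 ★★★ `hasMaj_dressedV_comp_commOp_cubeOp_out` — FILE 58's `hKcL` FOR THE DRESSED CUBE: `X∘[Σ∇*∇ + W + N − 𝒱, M_h] ≤ 1_S(y)·θ₀ᴸ·e^{−ρ₃d}`,
  `θ₀ᴸ = |J|(3β′c₂ + 2β′₂c₁) + θ_W + β′c_Nc_r + |J|·2r_A(c₁β′ + c₀β′₂) + β′(ℓ(eε)⁻¹ + 2ω)R_Nc_r` — every constant small when the partition varies slowly (`c₀, c₁, c₂, ℓ, ω, θ_W, c_N` carry the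
  `O(M⁻¹)`) except the local species' `r_A` terms, which carry `c₁`∕`c₀` as factors.

HONEST FRAMING ∕ LIMITS.  Finite-dimensional operator algebra + block-majorant bookkeeping over DISPLAYED letters (flat cube entries ∕ right entries ∕ cut-offs, `V̂`'s decay letter `R, δ_V`, species
rows `r_A`, partition `c₀, c₁, c₂, ℓ, ω`, the flat nonlocal commutator letter `c_N` and the base perturbation's `R_N, δ_N`) — none inhabited at the tree's objects here; [B5] (1.120)–(1.128)
pp. 37–39, [B6] (2.91)–(2.92) p. 239 ∕ (2.133)–(2.134) p. 247, [B9] (3.52) p. 400 ∕ (3.62)–(3.65) pp. 402–403 ∕ (3.76)–(3.77) pp. 405–406 = SHAPES ∕ MECHANISM — nothing of [B5]∕[B6]∕[B9]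
asserted.  NE2⁺ NOT PRINTED, NOT proved; N15 NOT discharged; counts of record UNMOVED (typed 28∕28 · discharged 5∕27); one finite 𝕋⁴ at fixed ε — NOT infinite volume, NOT OS on ℝ⁴, NOT a mass
gap, NOT Clay; R4 closes the conditional finite-𝕋⁴ rung `BalabanLadder.UV` only.  Restate-immune (no Theses import).
-/

set_option autoImplicit false

noncomputable section
open scoped BigOperators
open Finset

namespace Summit.QuantumFields.YangMills.BalabanUVNodes.N15.CurvedSpecies

open Literature.MathematicalPhysics.QuantumFieldTheory.Balaban1983to89
open Literature.MathematicalPhysics.QuantumFieldTheory.Balaban1983to89.B11SectG (BlockNorm HasMaj RowSum)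
open Literature.MathematicalPhysics.QuantumFieldTheory.Balaban1983to89.B6RandomWalk (Triangle254)
open Literature.MathematicalPhysics.QuantumFieldTheory.Balaban1983to89.B6Prop26Gluing (mulOp mulOp_apply ind ind_nonneg)
open Summit.QuantumFields.YangMills.BalabanUVNodes.N15.MatrixSpecies (liftBlk liftEquiv liftEquiv_apply liftEquiv_symm_apply)
open Summit.QuantumFields.YangMills.BalabanUVNodes.N15.BackgroundLayer (fgrad bgrad fgradAdj fgrad_apply bgrad_apply fgradAdj_apply stack projO blkPair unstackM bgPropV)
open Summit.QuantumFields.YangMills.BalabanUVNodes.N15.Gluing (commOp lapOp hasMaj_comp_commOp_lapOp hasMaj_comp_commOp_of_add)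

/-! ## §1 The flat adjoint half `X∘[Σ_μ∇*_μ∇_μ + W, M_h]`, two-sided, for the general dressed cube -/

section Flat

variable {X ι J : Type} [Fintype X] [DecidableEq X] [Fintype ι] [DecidableEq ι] [Fintype J] [DecidableEq J] {g : B6.Geometry} (blk : X → g.Site) (τ : J → X ≃ X) (n : ℝ)
  {σ cr : ℝ} {G₀ : (X × ι → ℝ) →ₗ[ℝ] (X × ι → ℝ)} {D Dq : J ⊕ J → (X × ι → ℝ) →ₗ[ℝ] (X × ι → ℝ)} {V : ((X × ι) × Option (J ⊕ J) → ℝ) →ₗ[ℝ] (X × ι → ℝ)}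

/-- ★★ **THE FLAT ADJOINT HALF OF THE REMAINDER ROW, TWO-SIDED** (dag-n15-w3's located (g), adjoint of dag-n15-w4's (h)): for the general dressed cube `X = pr₀(bgPropV (stack G₀ D) V̂)` of file 23 —
flat cube `G₀, D_j ≤ βe^{−δd}` with right entries `G₀∘∇^±_μ, D_j∘∇^±_μ ≤ β₂e^{−δd}`, output cut-off `M_χG₀ = G₀`, input cut-off `G₀M_ψ = G₀` over `S` and the one-step margin `ψ₂ = 1` on
`supp ψ ∪ τ_μ^{±1}(supp ψ)` (`supp ψ₂` over `S`), `D_j = Dq_j∘G₀`, perturbation `V̂ ≤ Re^{−δ_Vd}`, `βRc_r² < 1` — and a partition function `h` with `|∇^±_μh| ≤ c₁`, `|∇*_μ∇_μh|, |∇_μ∇_μh|,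
|∇⁻_μ((∇⁻_μh)∘τ_μ)| ≤ c₂` and `W`-row `X∘[W, M_h] ≤ 1_S1_S·θ_We^{−ρ₂d}`:  `X∘[Σ_μ∇*_μ∇_μ + W, M_h] ≤ 1_S(y)1_S(y′)·(|J|(3β′c₂ + 2β′₂c₁) + θ_W)·e^{−ρ₂d}`, `β′ = β(1 − βRc_r²)⁻¹`,
`β′₂ = β₂(1 − βRc_r²)⁻¹` — dag-n15-c FILE 49 `hasMaj_comp_commOp_lapOp` on file 23 `hasMaj_dressedV_loc₂` and dag-n15-w3 g4 `hasMaj_dressedV_comp_fgrad_loc₂` ∕ `hasMaj_dressedV_comp_bgrad_loc₂`.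
[cite: Balaban1984PropagatorsII, (2.91)–(2.92) p.239 (mechanism, transposed), (2.133)–(2.134) p.247 (shapes); Balaban1984PropagatorsI, p.39 (adjoint representation); Balaban1985BackgroundPropagators, (3.62)–(3.65) pp.402–403] -/
theorem hasMaj_comp_commOp_lapOp_dressedV_loc₂ (htri : Triangle254 g) (hd : ∀ a b : g.Site, 0 ≤ g.dist a b) (hrow : RowSum g σ cr) (hσ : 0 ≤ σ) {ρ₁ ρ₂ δ δV β β₂ R c₁ c₂ θW : ℝ}
    (hβ : 0 ≤ β) (hβ₂ : 0 ≤ β₂) (hR : 0 ≤ R) (hcr : 0 ≤ cr) (hσρ : σ ≤ ρ₁) (hρ₁V : ρ₁ ≤ δV) (hρ₁G : ρ₁ + σ ≤ δ) (hρ₂ : 0 ≤ ρ₂) (hρ₂₁ : ρ₂ + σ ≤ ρ₁) (hc₁ : 0 ≤ c₁) (hc₂ : 0 ≤ c₂)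
    (hDq : ∀ j, D j = Dq j ∘ₗ G₀) {S : Set g.Site} {χX ψX ψ₂X : X → ℝ} (hSχ : ∀ x, χX x ≠ 0 → blk x ∈ S) (hSψ : ∀ x, ψX x ≠ 0 → blk x ∈ S) (hSψ₂ : ∀ x, ψ₂X x ≠ 0 → blk x ∈ S)
    (hmf : ∀ μ x, ψX x ≠ 0 → ψ₂X x = 1 ∧ ψ₂X (τ μ x) = 1) (hmb : ∀ μ x, ψX x ≠ 0 → ψ₂X x = 1 ∧ ψ₂X ((τ μ).symm x) = 1)
    (hGχ : mulOp (fun p : X × ι => χX p.1) ∘ₗ G₀ = G₀) (hGψ : G₀ ∘ₗ mulOp (fun p : X × ι => ψX p.1) = G₀) {W : (X × ι → ℝ) →ₗ[ℝ] (X × ι → ℝ)} {h : X × ι → ℝ}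
    (hh1 : ∀ μ p, |fgrad n (liftEquiv (τ μ) ι) h p| ≤ c₁) (hh1b : ∀ μ p, |bgrad n (liftEquiv (τ μ) ι) h p| ≤ c₁)
    (hh2 : ∀ μ p, |fgradAdj n (liftEquiv (τ μ) ι) (fgrad n (liftEquiv (τ μ) ι) h) p| ≤ c₂) (hh2f : ∀ μ p, |fgrad n (liftEquiv (τ μ) ι) (fgrad n (liftEquiv (τ μ) ι) h) p| ≤ c₂)
    (hh2b : ∀ μ p, |bgrad n (liftEquiv (τ μ) ι) (bgrad n (liftEquiv (τ μ) ι) h ∘ ⇑(liftEquiv (τ μ) ι)) p| ≤ c₂)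
    (hG : HasMaj (BlockNorm.ofBlocks g (liftBlk blk ι)) (BlockNorm.ofBlocks g (liftBlk blk ι)) G₀ (fun y y' => β * Real.exp (-(δ * g.dist y y'))))
    (hD : ∀ j, HasMaj (BlockNorm.ofBlocks g (liftBlk blk ι)) (BlockNorm.ofBlocks g (liftBlk blk ι)) (D j) (fun y y' => β * Real.exp (-(δ * g.dist y y'))))
    (hGQf : ∀ μ, HasMaj (BlockNorm.ofBlocks g (liftBlk blk ι)) (BlockNorm.ofBlocks g (liftBlk blk ι)) (G₀ ∘ₗ fgrad n (liftEquiv (τ μ) ι)) (fun y y' => β₂ * Real.exp (-(δ * g.dist y y'))))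
    (hDQf : ∀ μ j, HasMaj (BlockNorm.ofBlocks g (liftBlk blk ι)) (BlockNorm.ofBlocks g (liftBlk blk ι)) (D j ∘ₗ fgrad n (liftEquiv (τ μ) ι)) (fun y y' => β₂ * Real.exp (-(δ * g.dist y y'))))
    (hGQb : ∀ μ, HasMaj (BlockNorm.ofBlocks g (liftBlk blk ι)) (BlockNorm.ofBlocks g (liftBlk blk ι)) (G₀ ∘ₗ bgrad n (liftEquiv (τ μ) ι)) (fun y y' => β₂ * Real.exp (-(δ * g.dist y y'))))
    (hDQb : ∀ μ j, HasMaj (BlockNorm.ofBlocks g (liftBlk blk ι)) (BlockNorm.ofBlocks g (liftBlk blk ι)) (D j ∘ₗ bgrad n (liftEquiv (τ μ) ι)) (fun y y' => β₂ * Real.exp (-(δ * g.dist y y'))))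
    (hV : HasMaj (BlockNorm.ofBlocks g (blkPair (liftBlk blk ι))) (BlockNorm.ofBlocks g (liftBlk blk ι)) V (fun y y' => R * Real.exp (-(δV * g.dist y y'))))
    (hq : β * (R * cr) * cr < 1)
    (hW : HasMaj (BlockNorm.ofBlocks g (liftBlk blk ι)) (BlockNorm.ofBlocks g (liftBlk blk ι)) ((projO none ∘ₗ bgPropV (stack G₀ D) V) ∘ₗ commOp W h)
      (fun y y' => ind S y * ind S y' * (θW * Real.exp (-(ρ₂ * g.dist y y'))))) :
    HasMaj (BlockNorm.ofBlocks g (liftBlk blk ι)) (BlockNorm.ofBlocks g (liftBlk blk ι))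
      ((projO none ∘ₗ bgPropV (stack G₀ D) V) ∘ₗ commOp (lapOp n (fun μ => liftEquiv (τ μ) ι) W) h)
      (fun y y' => ind S y * ind S y' * ((Fintype.card J * (3 * (β * (1 - β * (R * cr) * cr)⁻¹ * c₂) + 2 * (β₂ * (1 - β * (R * cr) * cr)⁻¹ * c₁)) + θW) *
        Real.exp (-(ρ₂ * g.dist y y')))) := by
  have hB : 0 ≤ β * (1 - β * (R * cr) * cr)⁻¹ := mul_nonneg hβ (inv_nonneg.2 (by linarith))
  have hB₂ : 0 ≤ β₂ * (1 - β * (R * cr) * cr)⁻¹ := mul_nonneg hβ₂ (inv_nonneg.2 (by linarith))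
  -- the dressed cube's two-sided entry 0 (file 23) and two-sided right entries (dag-n15-w3 g4)
  have hG0 := hasMaj_dressedV_loc₂ blk htri hd hrow hσ hβ hR hcr hσρ hρ₁V hρ₁G hρ₂ hρ₂₁ hSχ hSψ hGχ hGψ hDq hG hD hV hq
  have hDf := fun μ => hasMaj_dressedV_comp_fgrad_loc₂ blk τ n htri hd hrow hσ hβ hβ₂ hR hcr hσρ hρ₁V hρ₁G hρ₂ hρ₂₁ hDq μ hSχ hSψ₂ (hmf μ) hGχ hGψ hG hD (hGQf μ) (hDQf μ) hV hq
  have hDb := fun μ => hasMaj_dressedV_comp_bgrad_loc₂ blk τ n htri hd hrow hσ hβ hβ₂ hR hcr hσρ hρ₁V hρ₁G hρ₂ hρ₂₁ hDq μ hSχ hSψ₂ (hmb μ) hGχ hGψ hG hD (hGQb μ) (hDQb μ) hV hq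
  exact hasMaj_comp_commOp_lapOp (liftBlk blk ι) (e := fun μ => liftEquiv (τ μ) ι) hB hB₂ hc₁ hc₂ hh1 hh1b hh2 hh2f hh2b hG0 hDf hDb hW

end Flat

/-! ## §2 FILE 58's `hKcL` for the dressed cube: `X∘[Σ∇*∇ + W + N − 𝒱, M_h]`, output-localized, `𝒱 = V(C, A) + N_V` structural -/

section Row

variable {X ι J : Type} [Fintype X] [DecidableEq X] [Fintype ι] [DecidableEq ι] [Fintype J] [DecidableEq J] {g : B6.Geometry} (blk : X → g.Site) (τ : J → X ≃ X) (n : ℝ)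
  (C : X → Matrix ι ι ℝ) (A : J ⊕ J → X → Matrix ι ι ℝ) (hX : X → ℝ)
  {σ cr : ℝ} {G₀ : (X × ι → ℝ) →ₗ[ℝ] (X × ι → ℝ)} {D Dq : J ⊕ J → (X × ι → ℝ) →ₗ[ℝ] (X × ι → ℝ)} {NV : (X × ι → ℝ) →ₗ[ℝ] (X × ι → ℝ)}

/-- ★★★ **THE ADJOINT REMAINDER ROW OF THE DRESSED CUBE, FILE 58's `hKcL` SHAPE**: with §1's data for the perturbation `V̂ := unstackM C A + N_V∘pr₀` and the partition `h = h_X∘pr₁` (its scalar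
letters `|∇^±_μh_X| ≤ c₁`, `|h_X∘τ_μ − h_X| ≤ c₀`, within `ω` of an `ℓ`-block-Lipschitz block constant `hb`; the three second differences `≤ c₂` on the vector carrier), the species rows
`Σ_k|A^±_μ(x)_{ik}| ≤ r_A`, a flat NONLOCAL summand `N` through its commutator letter `[N, M_h] ≤ c_N·e^{−ρ_Nd}` (FILE 56), the base perturbation `N_V ≤ R_N·e^{−δ_Nd}`, symmetric distance,
`ε > 0`, rates `0 ≤ ρ₃`, `ρ₃ ≤ ρ_N`, `ρ₃ ≤ δ_N − ε`, `ρ₃ + σ ≤ ρ₂`:  `X∘[Σ∇*∇ + W + N − 𝒱, M_h] ≤ 1_S(y)·θ₀ᴸ·e^{−ρ₃d}`,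
`θ₀ᴸ = (|J|(3β′c₂ + 2β′₂c₁) + θ_W + β′c_Nc_r) + (|J|·2r_A(c₁β′ + c₀β′₂) + β′(ℓ(eε)⁻¹ + 2ω)R_Nc_r)`, `β′ = β(1 − βRc_r²)⁻¹`, `β′₂ = β₂(1 − βRc_r²)⁻¹` (`𝒱 = V̂∘jet = V(C,A) + N_V`).
[cite: Balaban1984PropagatorsI, (1.120)–(1.128) pp.37–38, p.39 (adjoint representation); Balaban1984PropagatorsII, (2.91)–(2.92) p.239, (2.133)–(2.134) p.247 (shapes + mechanism); Balaban1985BackgroundPropagators, (3.52) p.400, (3.62)–(3.65) pp.402–403, (3.76)–(3.77) pp.405–406] -/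
theorem hasMaj_dressedV_comp_commOp_cubeOp_out (htri : Triangle254 g) (hd : ∀ a b : g.Site, 0 ≤ g.dist a b) (hsymm : ∀ y y', g.dist y y' = g.dist y' y) (hrow : RowSum g σ cr)
    (hσ : 0 ≤ σ) {ρ₁ ρ₂ ρ₃ ρN δ δV δN ε β β₂ R c₀ c₁ c₂ θW cN rA RN ℓ ω : ℝ} (hβ : 0 ≤ β) (hβ₂ : 0 ≤ β₂) (hR : 0 ≤ R) (hcr : 0 ≤ cr) (hσρ : σ ≤ ρ₁) (hρ₁V : ρ₁ ≤ δV)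
    (hρ₁G : ρ₁ + σ ≤ δ) (hρ₂ : 0 ≤ ρ₂) (hρ₂₁ : ρ₂ + σ ≤ ρ₁) (hρ₃ : 0 ≤ ρ₃) (hρ₃N : ρ₃ ≤ ρN) (hρ₃V : ρ₃ ≤ δN - ε) (hρ₃₂ : ρ₃ + σ ≤ ρ₂) (hε : 0 < ε) (hc₀ : 0 ≤ c₀) (hc₁ : 0 ≤ c₁)
    (hc₂ : 0 ≤ c₂) (hθW : 0 ≤ θW) (hcN : 0 ≤ cN) (hrA : 0 ≤ rA) (hRN : 0 ≤ RN) (hℓ : 0 ≤ ℓ) (hω : 0 ≤ ω)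
    (hDqf : ∀ μ, Dq (Sum.inl μ) = fgrad n (liftEquiv (τ μ) ι)) (hDqb : ∀ μ, Dq (Sum.inr μ) = bgrad n (liftEquiv (τ μ) ι)) (hDq : ∀ j, D j = Dq j ∘ₗ G₀)
    {S : Set g.Site} {χX ψX ψ₂X : X → ℝ} (hSχ : ∀ x, χX x ≠ 0 → blk x ∈ S) (hSψ : ∀ x, ψX x ≠ 0 → blk x ∈ S) (hSψ₂ : ∀ x, ψ₂X x ≠ 0 → blk x ∈ S)
    (hmf : ∀ μ x, ψX x ≠ 0 → ψ₂X x = 1 ∧ ψ₂X (τ μ x) = 1) (hmb : ∀ μ x, ψX x ≠ 0 → ψ₂X x = 1 ∧ ψ₂X ((τ μ).symm x) = 1)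
    (hGχ : mulOp (fun p : X × ι => χX p.1) ∘ₗ G₀ = G₀) (hGψ : G₀ ∘ₗ mulOp (fun p : X × ι => ψX p.1) = G₀) {W N : (X × ι → ℝ) →ₗ[ℝ] (X × ι → ℝ)} {hb : g.Site → ℝ}
    -- the partition: scalar letters, block-constant comparison, second differences on the vector carrier
    (hh1 : ∀ μ x, |fgrad n (τ μ) hX x| ≤ c₁) (hh1b : ∀ μ x, |bgrad n (τ μ) hX x| ≤ c₁) (hh0 : ∀ μ x, |hX (τ μ x) - hX x| ≤ c₀)
    (hLip : ∀ y y', |hb y - hb y'| ≤ ℓ * g.dist y y') (hrh : ∀ x, |hX x - hb (blk x)| ≤ ω)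
    (hh2 : ∀ μ p, |fgradAdj n (liftEquiv (τ μ) ι) (fgrad n (liftEquiv (τ μ) ι) (fun p : X × ι => hX p.1)) p| ≤ c₂)
    (hh2f : ∀ μ p, |fgrad n (liftEquiv (τ μ) ι) (fgrad n (liftEquiv (τ μ) ι) (fun p : X × ι => hX p.1)) p| ≤ c₂)
    (hh2b : ∀ μ p, |bgrad n (liftEquiv (τ μ) ι) (bgrad n (liftEquiv (τ μ) ι) (fun p : X × ι => hX p.1) ∘ ⇑(liftEquiv (τ μ) ι)) p| ≤ c₂)
    (hA : ∀ j x i, ∑ k, |A j x i k| ≤ rA)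
    -- the flat cube, its right entries, the perturbation's letter, smallness
    (hG : HasMaj (BlockNorm.ofBlocks g (liftBlk blk ι)) (BlockNorm.ofBlocks g (liftBlk blk ι)) G₀ (fun y y' => β * Real.exp (-(δ * g.dist y y'))))
    (hD : ∀ j, HasMaj (BlockNorm.ofBlocks g (liftBlk blk ι)) (BlockNorm.ofBlocks g (liftBlk blk ι)) (D j) (fun y y' => β * Real.exp (-(δ * g.dist y y'))))
    (hGQf : ∀ μ, HasMaj (BlockNorm.ofBlocks g (liftBlk blk ι)) (BlockNorm.ofBlocks g (liftBlk blk ι)) (G₀ ∘ₗ fgrad n (liftEquiv (τ μ) ι)) (fun y y' => β₂ * Real.exp (-(δ * g.dist y y'))))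
    (hDQf : ∀ μ j, HasMaj (BlockNorm.ofBlocks g (liftBlk blk ι)) (BlockNorm.ofBlocks g (liftBlk blk ι)) (D j ∘ₗ fgrad n (liftEquiv (τ μ) ι)) (fun y y' => β₂ * Real.exp (-(δ * g.dist y y'))))
    (hGQb : ∀ μ, HasMaj (BlockNorm.ofBlocks g (liftBlk blk ι)) (BlockNorm.ofBlocks g (liftBlk blk ι)) (G₀ ∘ₗ bgrad n (liftEquiv (τ μ) ι)) (fun y y' => β₂ * Real.exp (-(δ * g.dist y y'))))
    (hDQb : ∀ μ j, HasMaj (BlockNorm.ofBlocks g (liftBlk blk ι)) (BlockNorm.ofBlocks g (liftBlk blk ι)) (D j ∘ₗ bgrad n (liftEquiv (τ μ) ι)) (fun y y' => β₂ * Real.exp (-(δ * g.dist y y'))))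
    (hV : HasMaj (BlockNorm.ofBlocks g (blkPair (liftBlk blk ι))) (BlockNorm.ofBlocks g (liftBlk blk ι)) (unstackM C A + NV ∘ₗ projO (none : Option (J ⊕ J)))
      (fun y y' => R * Real.exp (-(δV * g.dist y y'))))
    (hq : β * (R * cr) * cr < 1)
    -- the adjoint `W`-row, the flat nonlocal summand's commutator letter, the base perturbation's letter
    (hW : HasMaj (BlockNorm.ofBlocks g (liftBlk blk ι)) (BlockNorm.ofBlocks g (liftBlk blk ι))
      ((projO none ∘ₗ bgPropV (stack G₀ D) (unstackM C A + NV ∘ₗ projO (none : Option (J ⊕ J)))) ∘ₗ commOp W (fun p : X × ι => hX p.1))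
      (fun y y' => ind S y * ind S y' * (θW * Real.exp (-(ρ₂ * g.dist y y')))))
    (hKN : HasMaj (BlockNorm.ofBlocks g (liftBlk blk ι)) (BlockNorm.ofBlocks g (liftBlk blk ι)) (commOp N (fun p : X × ι => hX p.1)) (fun y y' => cN * Real.exp (-(ρN * g.dist y y'))))
    (hNV : HasMaj (BlockNorm.ofBlocks g (liftBlk blk ι)) (BlockNorm.ofBlocks g (liftBlk blk ι)) NV (fun y y' => RN * Real.exp (-(δN * g.dist y y')))) :
    HasMaj (BlockNorm.ofBlocks g (liftBlk blk ι)) (BlockNorm.ofBlocks g (liftBlk blk ι))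
      ((projO none ∘ₗ bgPropV (stack G₀ D) (unstackM C A + NV ∘ₗ projO (none : Option (J ⊕ J)))) ∘ₗ
        commOp (lapOp n (fun μ => liftEquiv (τ μ) ι) W + N - (unstackM C A + NV ∘ₗ projO (none : Option (J ⊕ J))) ∘ₗ stack LinearMap.id Dq) (fun p : X × ι => hX p.1))
      (fun y y' => ind S y * ((((Fintype.card J * (3 * (β * (1 - β * (R * cr) * cr)⁻¹ * c₂) + 2 * (β₂ * (1 - β * (R * cr) * cr)⁻¹ * c₁)) + θW)
          + β * (1 - β * (R * cr) * cr)⁻¹ * cN * cr)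
        + ((Fintype.card J * (2 * rA * (c₁ * (β * (1 - β * (R * cr) * cr)⁻¹) + c₀ * (β₂ * (1 - β * (R * cr) * cr)⁻¹))))
          + β * (1 - β * (R * cr) * cr)⁻¹ * ((ℓ * (Real.exp 1 * ε)⁻¹ + 2 * ω) * RN) * cr)) * Real.exp (-(ρ₃ * g.dist y y')))) := by
  have hB : 0 ≤ β * (1 - β * (R * cr) * cr)⁻¹ := mul_nonneg hβ (inv_nonneg.2 (by linarith))
  have hB₂ : 0 ≤ β₂ * (1 - β * (R * cr) * cr)⁻¹ := mul_nonneg hβ₂ (inv_nonneg.2 (by linarith))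
  -- the partition's first differences on the vector carrier, from the scalar letters
  have hh1v : ∀ μ p, |fgrad n (liftEquiv (τ μ) ι) (fun p : X × ι => hX p.1) p| ≤ c₁ := fun μ p => by
    simpa only [fgrad_apply, liftEquiv_apply] using hh1 μ p.1
  have hh1bv : ∀ μ p, |bgrad n (liftEquiv (τ μ) ι) (fun p : X × ι => hX p.1) p| ≤ c₁ := fun μ p => by
    simpa only [bgrad_apply, liftEquiv_symm_apply] using hh1b μ p.1
  -- §1: the flat adjoint half (two-sided), and the dressed cube's two-sided entry 0 ∕ right entries
  have hflat := hasMaj_comp_commOp_lapOp_dressedV_loc₂ blk τ n htri hd hrow hσ hβ hβ₂ hR hcr hσρ hρ₁V hρ₁G hρ₂ hρ₂₁ hc₁ hc₂ hDq hSχ hSψ hSψ₂ hmf hmb hGχ hGψ hh1v hh1bv hh2 hh2f hh2b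
    hG hD hGQf hDQf hGQb hDQb hV hq hW
  have hG0 := hasMaj_dressedV_loc₂ blk htri hd hrow hσ hβ hR hcr hσρ hρ₁V hρ₁G hρ₂ hρ₂₁ hSχ hSψ hGχ hGψ hDq hG hD hV hq
  have hDf := fun μ => hasMaj_dressedV_comp_fgrad_loc₂ blk τ n htri hd hrow hσ hβ hβ₂ hR hcr hσρ hρ₁V hρ₁G hρ₂ hρ₂₁ hDq μ hSχ hSψ₂ (hmf μ) hGχ hGψ hG hD (hGQf μ) (hDQf μ) hV hq
  have hDb := fun μ => hasMaj_dressedV_comp_bgrad_loc₂ blk τ n htri hd hrow hσ hβ hβ₂ hR hcr hσρ hρ₁V hρ₁G hρ₂ hρ₂₁ hDq μ hSχ hSψ₂ (hmb μ) hGχ hGψ hG hD (hGQb μ) (hDQb μ) hV hq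
  -- add the flat nonlocal summand through the cube's output (FILE 57)
  have hθ : 0 ≤ Fintype.card J * (3 * (β * (1 - β * (R * cr) * cr)⁻¹ * c₂) + 2 * (β₂ * (1 - β * (R * cr) * cr)⁻¹ * c₁)) + θW := by positivity
  have h1 := hasMaj_comp_commOp_of_add (liftBlk blk ι) htri hd hrow hσ hθ hcN hB hρ₃ hρ₃N hρ₃₂ hflat hKN hG0
  -- subtract the dressed perturbation's adjoint half (this seat's `…CommutatorAdjoint`, structural `𝒱 = V(C,A) + N_V`)
  have h2 := hasMaj_comp_commOp_speciesOpM_add blk τ n C A hX (projO none ∘ₗ bgPropV (stack G₀ D) (unstackM C A + NV ∘ₗ projO (none : Option (J ⊕ J)))) htri hd hsymm hrow hσ hB hB₂ hc₁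
    hc₀ hrA hRN hℓ hω hε hρ₃ hρ₃V hρ₃₂ hh1 hh1b hh0 hLip hrh hA hG0 hDf hDb hNV
  have hDqE : Dq = fun j : J ⊕ J => Sum.elim (fun μ => fgrad n (liftEquiv (τ μ) ι)) (fun μ => bgrad n (liftEquiv (τ μ) ι)) j := by
    funext j
    rcases j with μ | μ
    · exact hDqf μ
    · exact hDqb μ
  subst hDqE
  rw [unstackM_add_base_comp_jet, commOp_sub_left, LinearMap.comp_sub]
  refine (h1.sub h2).mono fun y y' => le_of_eq ?_
  ring

end Row

end Summit.QuantumFields.YangMills.BalabanUVNodes.N15.CurvedSpecies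

end
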